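import Summits.QuantumFields.YangMills.Theorems.FemtoCutoffLadderLargeFieldInsensitivityTopPos

/-!
# Route `FemtoCutoffLadder`, LINE g5-A «one plaquette wall at a time»: the WALLED top value is positive for EVERY wall set, unconditionally

Lead seat `ym-line-fcl-p1` g9 (2026-08-28).  The items `LocalWallStep` (stmt-QuantumFields-26282), `SingleWallStep` (26631) and
`LastWallStep` (26638) all begin with `0 < t Q ∧ 0 < t (Q ∪ {p₀})`, where `t Q = sSup (rayleighSet su2Rep L β (W Q))` is the top Rayleigh value
over physical test functions vanishing at every configuration with a κ-bad plaquette IN THE WALL SET `Q`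
(`W Q ψ := ∀ U, (∃ p ∈ Q, β^{κ−1} < 2 − Re tr U_p) → ψ U = 0`).  These clauses hold on EVERY lattice, for EVERY `β > 0`, EVERY real `κ` and
EVERY `Q ⊆ Plaquette 3 L`, with no window: the indicator of the `Q`-good set `{U | ∀ p ∈ Q, 2 − Re tr U_p ≤ β^{κ−1}}` is physical
(`SFCompression.cutoffs_isPhys_of_invariant`: measurable, gauge- and twist-invariant bad event), is supported where `W Q` requires, has positive
`L²` mass (the `Q`-good set contains the open neighbourhood `{∀ p, 2 − Re tr U_p < β^{κ−1}}` of the trivial configuration, and the a-priori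
measure charges open sets), and `⟨1, K_β 1⟩`-type positivity of the kernel does the rest — verbatim the argument of
`SFCompression.smallFieldTop_pos` (lead g8, p607603; the case `Q = univ`).
★ `walledTop_pos : 0 < β → 0 < sSup (rayleighSet su2Rep L β (W Q))` — so a prover of 26282 / 26631 / 26638 proves the two COMPARISON clauses only
(by-name reductions in `FemtoCutoffLadderLocalWallReductions.lean`).
HONEST FRAMING: elementary; the comparison clauses (the content) are untouched.  R2b1 is a RECORD rung — not infinite volume, not a mass gap,
not Clay; no summit is proved by this line.  No definitions, no named facts, no `sorry`.
-/

set_option autoImplicit false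

noncomputable section

open MeasureTheory Filter Topology Real
open Literature.MathematicalPhysics.QuantumFieldTheory
open Literature.MathematicalPhysics.QuantumLattice

namespace Summit.QuantumFields.YangMills.Theorems.FemtoTransferGap.SFCompression

variable {L : ℕ} [NeZero L]

/-- ★ **The walled top value is positive, for every wall set.**  For `β > 0`, any real `κ` and any `Q ⊆ Plaquette 3 L`:
`0 < sSup (rayleighSet su2Rep L β (W Q))`, `W Q ψ := ∀ U, (∃ p ∈ Q, β^{κ−1} < 2 − Re tr U_p) → ψ U = 0`. [folklore] -/
theorem walledTop_pos (L : ℕ) [NeZero L] {β : ℝ} (hβ : 0 < β) (κ : ℝ) (Q : Set (Plaquette 3 L)) :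
    0 < sSup (rayleighSet su2Rep L β fun ψ => ∀ U : GaugeConfig 3 L SU2,
      (∃ p ∈ Q, β ^ (κ - 1) < 2 - (su2Rep (plaquetteHolonomy U p.1 p.2.1.1 p.2.1.2)).trace.re) → ψ U = 0) := by
  classical
  set c : ℝ := β ^ (κ - 1) with hc
  have hcpos : 0 < c := Real.rpow_pos_of_pos hβ _
  set S : Set (GaugeConfig 3 L SU2) := {U | ¬ ∃ p ∈ Q,
    c < 2 - (su2Rep (plaquetteHolonomy U p.1 p.2.1.1 p.2.1.2)).trace.re} with hS
  set ψ : GaugeConfig 3 L SU2 → ℝ := S.indicator fun _ => (1 : ℝ) with hψdef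
  -- the `Q`-bad event is measurable, gauge- and twist-invariant
  have hBm : MeasurableSet {U : GaugeConfig 3 L SU2 | ∃ p ∈ Q,
      c < 2 - (su2Rep (plaquetteHolonomy U p.1 p.2.1.1 p.2.1.2)).trace.re} := by
    have h : {U : GaugeConfig 3 L SU2 | ∃ p ∈ Q, c < 2 - (su2Rep (plaquetteHolonomy U p.1 p.2.1.1 p.2.1.2)).trace.re}
        = ⋃ p : Plaquette 3 L, {U | p ∈ Q ∧ c < 2 - (su2Rep (plaquetteHolonomy U p.1 p.2.1.1 p.2.1.2)).trace.re} := by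
      ext U; simp only [Set.mem_setOf_eq, Set.mem_iUnion]
    rw [h]
    refine MeasurableSet.iUnion fun p => ?_
    by_cases hp : p ∈ Q
    · have : {U : GaugeConfig 3 L SU2 | p ∈ Q ∧ c < 2 - (su2Rep (plaquetteHolonomy U p.1 p.2.1.1 p.2.1.2)).trace.re}
          = {U | c < 2 - (su2Rep (plaquetteHolonomy U p.1 p.2.1.1 p.2.1.2)).trace.re} := by
        ext U; simp only [Set.mem_setOf_eq, hp, true_and]
      rw [this]
      exact measurableSet_lt measurable_const (continuous_plaquetteDeviation p).measurable
    · have : {U : GaugeConfig 3 L SU2 | p ∈ Q ∧ c < 2 - (su2Rep (plaquetteHolonomy U p.1 p.2.1.1 p.2.1.2)).trace.re} = ∅ := by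
        ext U; simp only [Set.mem_setOf_eq, hp, false_and, Set.mem_empty_iff_false]
      rw [this]
      exact MeasurableSet.empty
  have hψ : IsPhys ψ := by
    have h := (cutoffs_isPhys_of_invariant (L := L)
      (B := fun U => ∃ p ∈ Q, c < 2 - (su2Rep (plaquetteHolonomy U p.1 p.2.1.1 p.2.1.2)).trace.re) hBm ?_ ?_ (isPhys_const 1)).1
    · exact h
    · intro g U
      refine exists_congr fun p => and_congr_right fun _ => ?_
      rw [Literature.MathematicalPhysics.QuantumLattice.plaquetteHolonomy_gaugeTransform, trace_su2Rep_conj]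
    · intro k z hz U
      refine exists_congr fun p => and_congr_right fun _ => ?_
      rw [plaquetteHolonomy_twist_of_mem_center k hz U p.1 (ne_of_lt p.2.2)]
  have hψ0 : ∀ V, 0 ≤ ψ V := fun V => Set.indicator_nonneg (fun _ _ => zero_le_one) V
  have hP : ∀ U : GaugeConfig 3 L SU2,
      (∃ p ∈ Q, c < 2 - (su2Rep (plaquetteHolonomy U p.1 p.2.1.1 p.2.1.2)).trace.re) → ψ U = 0 := by
    intro U hU
    have hUS : U ∉ S := fun h => h hU
    simp [hψdef, Set.indicator_of_notMem hUS]
  -- `S` is measurable and contains an open neighbourhood of the trivial configuration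
  have hSm : MeasurableSet S := by
    have := hBm.compl
    rwa [Set.compl_setOf] at this
  set O : Set (GaugeConfig 3 L SU2) := ⋂ p : Plaquette 3 L,
    {U | 2 - (su2Rep (plaquetteHolonomy U p.1 p.2.1.1 p.2.1.2)).trace.re < c} with hO
  have hOopen : IsOpen O :=
    isOpen_iInter_of_finite fun p => isOpen_lt (continuous_plaquetteDeviation p) continuous_const
  have hOne : (1 : GaugeConfig 3 L SU2) ∈ O := by
    simp only [hO, Set.mem_iInter, Set.mem_setOf_eq]
    intro p
    have : (su2Rep (plaquetteHolonomy (1 : GaugeConfig 3 L SU2) p.1 p.2.1.1 p.2.1.2)).trace.re = 2 := by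
      rw [plaquetteHolonomy_one, map_one, Matrix.trace_one]
      simp
    rw [this]; linarith
  have hOS : O ⊆ S := by
    intro U hU hex
    obtain ⟨p, -, hp⟩ := hex
    have hU' : 2 - (su2Rep (plaquetteHolonomy U p.1 p.2.1.1 p.2.1.2)).trace.re < c := by
      have := Set.mem_iInter.mp hU p
      simpa only [Set.mem_setOf_eq] using this
    linarith
  haveI := PhysL2.isOpenPosMeasure_configMeasure (L := L)
  have hμO : 0 < (configMeasure SU2 L) O := hOopen.measure_pos _ ⟨1, hOne⟩
  have hμS : 0 < (configMeasure SU2 L).real S := by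
    rw [Measure.real, ENNReal.toReal_pos_iff]
    exact ⟨lt_of_lt_of_le hμO (measure_mono hOS), measure_lt_top _ _⟩
  -- `‖ψ‖² = μ(S) > 0`
  have hint1 : ∫ V, ψ V ∂(configMeasure SU2 L) = (configMeasure SU2 L).real S := by
    rw [hψdef]
    exact integral_indicator_one hSm
  have hl2 : l2 ψ ψ = (configMeasure SU2 L).real S := by
    unfold l2
    have : (fun U => ψ U * ψ U) = ψ := by
      funext U
      by_cases hU : U ∈ S
      · simp [hψdef, Set.indicator_of_mem hU]
      · simp [hψdef, Set.indicator_of_notMem hU]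
    rw [this, hint1]
  have hl2pos : 0 < l2 ψ ψ := by rw [hl2]; exact hμS
  -- `⟨ψ, K_β ψ⟩ ≥ (inf K) μ(S)² > 0`
  obtain ⟨m, hm0, hm⟩ := exists_pos_le_transferKernel su2Rep continuous_su2Rep β (L := L)
  have hq : 0 < qform su2Rep β ψ ψ := by
    have h := sq_integral_le_qform β hm hψ hψ0
    rw [hint1] at h
    exact lt_of_lt_of_le (by positivity) h
  exact sSup_rayleighSet_pos_of_witness β hψ hP hl2pos hq

end Summit.QuantumFields.YangMills.Theorems.FemtoTransferGap.SFCompression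

end
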